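import Summits.AtomisticToContinuum.HydrodynamicLimit.Theses.KnudsenRateHorizon
import HarnessLib

/-!
# Birth skeleton (BC3) for crux `EntropyKnudsenRateInBand` — item stmt-AtomisticToContinuum-17776,
# route `KnudsenRateHorizon` (rank 0, the route's packing-guarded Knudsen-rate target X), sub-problem `HydrodynamicLimit`

Crux BY NAME: `Summit.AtomisticToContinuum.HydrodynamicLimit.Theses.KnudsenRateHorizon.EntropyKnudsenRateInBand`
(∃ η₀ > 0 ∀ continuous positive profiles ∃ σ₀ ∀ 0 < σ < σ₀ ∀ classical hs-Euler solutions IN THE PACKING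
BAND `ρ_t σ³ < η₀` on `[0,T)` ∀ flow families: the initial local Gibbs laws are probability laws and, if
their fields converge at `t = 0`, then at every `t < T` some local Gibbs reference `(a, u_t, θ_t)` is a
probability law concentrating exponentially around `(ρ, ρu, E)(t)` with the KNUDSEN-RATE entropy bound
`klDiv (lawAt Φ_N (localGibbs a₀ u₀ θ₀) t ‖ localGibbs a u_t θ_t) ≤ C (N+1)^(2/3) = C (N+1) Kn_N`).

THE LINE is the route's own (module docstring of the route file, §Assembly / RANKED CRUXES #3 / support
#10 `KnudsenBandGlueInBand` stmt-17777 = `MeanFieldKnudsenAccuracy → EntropySaturationKnudsen →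
EntropyKnudsenRateInBand`): by the exact ENTROPY-SATURATION IDENTITY (Liouville invariance of the Shannon
entropy + log-linearity of hard-sphere local Gibbs laws in the empirical measure + isentropy of smooth
Euler flow, inside the cluster-expansion band) the relative entropy per particle `H_N(t)/(N+1)` equals ONE
linear statistic `Θ^a_N(t)` of the expected empirical fields up to `O((N+1)^(-1/3))`; hence X splits into

* `stub_meanFieldKnudsenAccuracy` — **HYDRODYNAMICS IN THE MEAN TO NAVIER–STOKES PRECISION** (the
  route's crux #3 BY NAME, item stmt-AtomisticToContinuum-12341, rank 3, open-problem; the DYNAMICAL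
  half, load-bearing): for `t < T` there is a positive reference activity `a` (probability + exponential
  concentration of the three reference fields) with `Θ^a_N(t) ≤ C (N+1)^(-1/3)` for all `N`, where
  `Θ^a_N(t) = E_λ⟨emp, log g^a_t⟩ − E_{P_N}⟨emp ∘ flow_t, log g^a_t⟩`, `g^a_t = localGibbsProfile a u_t θ_t`.
  Its own foreseen layer-2 split (route header, Two-layer plan; unfiled) is crux #2
  `KineticFluxRelaxation` + a remainder-form collisional twin + a static mean-rate LLN.
* `stub_entropySaturationKnudsen` — **QUANTITATIVE ENTROPY-SATURATION IDENTITY, band-guarded ENNReal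
  form** (the route's support item stmt-AtomisticToContinuum-14322 BY NAME, size L; the STATISTICAL-
  MECHANICS half): `∃ ηs > 0` such that, under the hypotheses of X and the band `ρ_s σ³ < ηs` on
  `[0,t]`, for EVERY positive reference activity `a` with probability + concentration clauses,
  `∃ C ∀ N, ofReal ((N+1)(Θ^a_N(t) − C (N+1)^(-1/3))) ≤ klDiv ≤ ofReal ((N+1)(Θ^a_N(t) + C (N+1)^(-1/3)))`.
  Only the upper half is consumed below.

Both stubs are stated BY NAME over the route's decls, so the registered obligations DEDUP to the existing
route items (12341, 14322) — no parallel statements are created. The composition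
`EntropyKnudsenRateInBand_of : MeanFieldKnudsenAccuracy → EntropySaturationKnudsen → EntropyKnudsenRateInBand`
is PROVED below (no sorry; ~20 lines of logic + one line of real arithmetic): `η₀ := ηs` (the saturation
identity's band threshold), `σ₀ := min σ₁ σ₂` of the two profile-wise thresholds; for `σ < σ₀`, a guarded
solution, `Φ` and `t ∈ [0,T)`: probability of the initial laws and the witness `a` (`a > 0`, probability,
concentration, `Θ^a_N(t) ≤ C₁ (N+1)^(-1/3)`) from stub 1; the Statement-shaped guard on `[0,T)` gives the
band on `[0,t]`; stub 2 gives `klDiv ≤ ofReal ((N+1)(Θ^a_N(t) + C₂ (N+1)^(-1/3))) ≤ ofReal ((C₁+C₂)(N+1)^(2/3))`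
(`(N+1)·(N+1)^(-1/3) = (N+1)^(2/3)`, `Real.rpow_add`). Its statement is VERBATIM the route's support item
`KnudsenBandGlueInBand` (stmt-17777, "provable-now"), which a prover may land in `Theorems/` from this file.

Disproof used: none exists for this crux (no `Cruxes/EntropyKnudsenRateInBand/Disproof.lean`, no
`_false_without_` theorem, no landed `Negative/` lemma at registration time). Typing checklist 4c: the
thresholds `η₀, σ₀` are existential and ASSEMBLED (`ηs`, `min`), never hand-picked; every measure clause is
about probability laws; `∃ C ∀ N` absorbs small `N`; `0 < T` is never assumed (the `t ∈ [0,T)` binder keeps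
the `T ≤ 0` corner vacuous exactly as in the crux).

BC3 probes (folder `bc/EntropyKnudsenRateInBand_probe.lean`, this seat): for each stub S,
`S → EntropyKnudsenRateInBand` and `S → _root_.HydrodynamicLimit` by
`first | exact? | simpa | simpa [S, C] | aesop` MUST FAIL — results quoted in `Lines/birth.md`.
-/

namespace Summit.AtomisticToContinuum.HydrodynamicLimit.Cruxes.EntropyKnudsenRateInBand.Birth

open Summit.AtomisticToContinuum.HydrodynamicLimit.Theses.KnudsenRateHorizon

/-- **Stub 1 (load-bearing, open-problem): hydrodynamics in the mean to Navier–Stokes precision** —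
the route's crux #3 `MeanFieldKnudsenAccuracy` BY NAME (item stmt-AtomisticToContinuum-12341). -/
theorem stub_meanFieldKnudsenAccuracy : MeanFieldKnudsenAccuracy := by
  sorry

/-- **Stub 2 (size L): the quantitative entropy-saturation identity in the packing band** — the
route's support item `EntropySaturationKnudsen` BY NAME (item stmt-AtomisticToContinuum-14322). -/
theorem stub_entropySaturationKnudsen : EntropySaturationKnudsen := by
  sorry

/-- Real arithmetic of the composition: `n (Θ + C₂ r) ≤ (C₁ + C₂) p` from `Θ ≤ C₁ r`, `n r = p`, `0 < n`
(used with `n = N+1`, `r = (N+1)^(-1/3)`, `p = (N+1)^(2/3)`). -/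
theorem knudsen_arith (Θ r p C₁ C₂ n : ℝ) (hn : 0 < n) (hΘ : Θ ≤ C₁ * r) (hp : n * r = p) :
    n * (Θ + C₂ * r) ≤ (C₁ + C₂) * p := by
  calc n * (Θ + C₂ * r) ≤ n * (C₁ * r + C₂ * r) :=
        mul_le_mul_of_nonneg_left (add_le_add hΘ le_rfl) hn.le
    _ = (C₁ + C₂) * (n * r) := by ring
    _ = (C₁ + C₂) * p := by rw [hp]

/-- `(N+1) · (N+1)^(-1/3) = (N+1)^(2/3)` — the Knudsen bookkeeping `(N+1) · Kn_N = (N+1)^(2/3)`. -/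
theorem succ_mul_rpow_neg_third (N : ℕ) :
    ((N : ℝ) + 1) * ((N : ℝ) + 1) ^ (-(1 / 3 : ℝ)) = ((N : ℝ) + 1) ^ (2 / 3 : ℝ) := by
  have hN : (0 : ℝ) < (N : ℝ) + 1 := by positivity
  have h := Real.rpow_add hN (1 : ℝ) (-(1 / 3 : ℝ))
  rw [Real.rpow_one] at h
  rw [← h]
  norm_num

/-- **COMPOSITION (sorry-free): the two stubs imply the crux BY NAME.** This is verbatim the route's
glue item `KnudsenBandGlueInBand` (stmt-AtomisticToContinuum-17777): `η₀ := ηs`, `σ₀ := min σ₁ σ₂`,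
witness `a` from stub 1, band on `[0,t]` from the Statement-shaped guard on `[0,T)`, upper half of
stub 2, `(N+1)(C₁ (N+1)^(-1/3) + C₂ (N+1)^(-1/3)) = (C₁ + C₂)(N+1)^(2/3)`. -/
theorem EntropyKnudsenRateInBand_of :
    MeanFieldKnudsenAccuracy → EntropySaturationKnudsen →
      Summit.AtomisticToContinuum.HydrodynamicLimit.Theses.KnudsenRateHorizon.EntropyKnudsenRateInBand := by
  intro hMF hES
  obtain ⟨ηs, hηs, hES⟩ := hES
  refine ⟨ηs, hηs, fun a₀ θ₀ u₀ ha hθ hu ha0 hθ0 => ?_⟩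
  obtain ⟨σ₁, hσ₁, H1⟩ := hMF a₀ θ₀ u₀ ha hθ hu ha0 hθ0
  obtain ⟨σ₂, hσ₂, H2⟩ := hES a₀ θ₀ u₀ ha hθ hu ha0 hθ0
  refine ⟨min σ₁ σ₂, lt_min hσ₁ hσ₂, fun σ hσ hσ' T ρ θ u hsol hg Φ => ?_⟩
  have hσ1 : σ < σ₁ := lt_of_lt_of_le hσ' (min_le_left _ _)
  have hσ2 : σ < σ₂ := lt_of_lt_of_le hσ' (min_le_right _ _)
  obtain ⟨hprob, H1⟩ := H1 σ hσ hσ1 T ρ θ u hsol Φ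
  refine ⟨hprob, fun hinit t ht => ?_⟩
  obtain ⟨a, hapos, haprob, hconc, C₁, hC₁⟩ := H1 hinit t ht
  have hband : ∀ s ∈ Set.Icc (0 : ℝ) t, ∀ x, ρ s x * σ ^ 3 < ηs := fun s hs x =>
    hg s ⟨hs.1, lt_of_le_of_lt hs.2 ht.2⟩ x
  obtain ⟨C₂, hC₂⟩ := H2 σ hσ hσ2 T ρ θ u hsol Φ hinit t ht hband a hapos haprob hconc
  refine ⟨a, haprob, hconc, C₁ + C₂, fun N => ?_⟩
  have hN : (0 : ℝ) < (N : ℝ) + 1 := by positivity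
  exact le_trans (hC₂ N).1 (ENNReal.ofReal_le_ofReal
    (knudsen_arith _ _ _ _ _ _ hN (hC₁ N) (succ_mul_rpow_neg_third N)))

/-- The skeleton applied to the sorried stubs: the crux BY NAME, conditional on exactly the two stubs. -/
theorem EntropyKnudsenRateInBand_skeleton :
    Summit.AtomisticToContinuum.HydrodynamicLimit.Theses.KnudsenRateHorizon.EntropyKnudsenRateInBand :=
  EntropyKnudsenRateInBand_of stub_meanFieldKnudsenAccuracy stub_entropySaturationKnudsen

/-- The composition also proves the route's glue item `KnudsenBandGlueInBand` (stmt-17777) by name. -/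
theorem knudsenBandGlueInBand_of : KnudsenBandGlueInBand :=
  EntropyKnudsenRateInBand_of

end Summit.AtomisticToContinuum.HydrodynamicLimit.Cruxes.EntropyKnudsenRateInBand.Birth
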